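import Summits.HodgeConjecture.HodgeConjecture.Theorems.Q8QuaternionicTransvectionDensity
import Literature.AlgebraicGeometry.HodgeTheory.UnitaryReflectionLieClosure
import Literature.NumberTheory.Automorphic.LieAlgebraGLBilinearForm
import Literature.NumberTheory.Automorphic.LieStableSubspaceStabilizer
import Mathlib.LinearAlgebra.Matrix.BilinearForm
import HarnessLib

/-!
# Route `Q8SymplecticPowers`, crux K1Q — the Lie algebra of the Zariski closure of a quaternionic monodromy group:
# what `Γ` preserves, `Lie(Γ)` preserves (commutation with `a, b`, skewness for `Q`), and STRONG irreducibility of `Γ` on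
# `M = ker(a − i)` makes `Lie(Γ)` irreducible on `M` (the «group wrapper» inputs of BQ-CORE)

Support file for crux K1Q (stmt-HodgeConjecture-24190; `--supports … --as helper`; nothing here closes an item). Prover seat
`hodge-nonav-prover-Ax` (g17). Vocabulary: `Γ ≤ GL(V)`, a basis `bV` of `V` with its matrix isomorphism `Ψ : GL(V) ≃* GL_ι(K)`
(`exists_mulEquiv_coe_eq_toMatrix`), the matrix group `Γ.map Ψ` and its Lie algebra `lieAlgebraGL (Γ.map Ψ) ⊆ Matrix ι ι K`
(`Literature/NumberTheory/Automorphic`), read on endomorphisms `Y` of `V` through `[Y]_{bV} ∈ lieAlgebraGL (Γ.map Ψ)`.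

* §1 `comm_of_toMatrix_mem_lieAlgebraGL` — if every `γ ∈ Γ` commutes with `f` then so does every such `Y` (Springer 4.4.15,
  tree `lie_eq_zero_of_mem_lieAlgebraGL_of_forall_conj_eq`); `skew_of_toMatrix_mem_lieAlgebraGL` — if every `γ ∈ Γ` is a
  `Q`-isometry then every such `Y` is `Q`-skew (Springer 7.4.7 (3)(b), tree `transpose_mul_add_mul_eq_zero_of_mem_lieAlgebraGL`).
* §2 (`K = ℂ`) `eq_bot_or_eq_of_lie_stable_of_sirr` — if every finite-index subgroup of `Γ` leaves invariant no subspace of a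
  fixed `M ≤ V` other than `⊥, M`, then every `Lie(Γ)`-stable `W ≤ M` is `⊥` or `M` (tree
  `eq_bot_or_eq_of_lieAlgebraGL_stable_of_forall_finiteIndex`, transported through `bV`).
* §3 the symplectic form `ω(x, y) = Q(x, b y)` of the quaternionic datum restricted to `M = ker(a − i)` is alternating and
  non-degenerate (`omegaM_isAlt`, `omegaM_nondegenerate`), and `M ∖ {0}` is ω-orthogonally connected (`sirr_conn`).
HONEST FRAMING: linear algebra only (axioms standard, no named fact); item 24190 OPEN; nothing about the Hodge conjecture.

## References
* [SpringerLAG1998] T. A. Springer, *Linear Algebraic Groups*, 2nd ed. (1998), 4.4.15, 7.4.7 (3)(b).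
* [TauvelYu2005] P. Tauvel, R. W. T. Yu, *Lie Algebras and Algebraic Groups* (2005), 24.3.5.
-/

noncomputable section

set_option linter.dupNamespace false

namespace Summit.HodgeConjecture.HodgeConjecture.Theorems.Q8MonodromyLieAlgebra

open Module Literature.NumberTheory.Automorphic Literature.AlgebraicGeometry.HodgeTheory
open Summit.HodgeConjecture.HodgeConjecture.Theorems.Q8CommutatorDegreeTwoCoreTransvections
open Summit.HodgeConjecture.HodgeConjecture.Theorems.Q8QuaternionicTransvectionDensity
open LinearMap (BilinForm)
open scoped MatrixGroups Matrix

/-! ### §1 What `Γ` preserves, `Lie(Γ)` preserves -/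

section General

variable {K : Type*} [Field K] {V : Type*} [AddCommGroup V] [Module K V] {ι : Type*} [Fintype ι] [DecidableEq ι]
  (bV : Basis ι K V) (Ψ : (V ≃ₗ[K] V) ≃* GL ι K)
  (hΨ : ∀ g : V ≃ₗ[K] V, ((Ψ g : GL ι K) : Matrix ι ι K) = LinearMap.toMatrix bV bV (g : V →ₗ[K] V))
  (Γ : Subgroup (V ≃ₗ[K] V))

include hΨ in
/-- **Commutation passes to the Lie algebra**: if every `γ ∈ Γ` commutes with `f`, so does every endomorphism `Y` with
`[Y]_{bV} ∈ Lie(Γ)` (the conjugation orbit of `[f]` under `Γ` is constant; Springer 4.4.15). -/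
theorem comm_of_toMatrix_mem_lieAlgebraGL {f : V →ₗ[K] V} (hΓf : ∀ γ ∈ Γ, ∀ x, γ (f x) = f (γ x))
    {Y : Module.End K V} (hY : LinearMap.toMatrix bV bV Y ∈ lieAlgebraGL (Γ.map Ψ.toMonoidHom)) (x : V) :
    Y (f x) = f (Y x) := by
  have hconj : ∀ t ∈ Γ.map Ψ.toMonoidHom,
      (t : Matrix ι ι K) * LinearMap.toMatrix bV bV f * ((t⁻¹ : GL ι K) : Matrix ι ι K) = LinearMap.toMatrix bV bV f := by
    rintro _ ⟨γ, hγ, rfl⟩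
    change ((Ψ γ : GL ι K) : Matrix ι ι K) * _ * (((Ψ γ)⁻¹ : GL ι K) : Matrix ι ι K) = _
    rw [← map_inv, hΨ, hΨ, ← LinearMap.toMatrix_mul, ← LinearMap.toMatrix_mul]
    congr 1
    refine LinearMap.ext fun y => ?_
    change γ (f (γ.symm y)) = f y
    rw [hΓf γ hγ, LinearEquiv.apply_symm_apply]
  have h := lie_eq_zero_of_mem_lieAlgebraGL_of_forall_conj_eq hconj hY
  rw [← LinearMap.toMatrix_mul, ← LinearMap.toMatrix_mul, ← map_sub, LinearEquiv.map_eq_zero_iff, sub_eq_zero] at h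
  exact LinearMap.congr_fun h x

include hΨ in
/-- **Isometry passes to skewness**: if every `γ ∈ Γ` preserves the bilinear form `Q` then every endomorphism `Y` with
`[Y]_{bV} ∈ Lie(Γ)` is `Q`-skew, `Q(Y x, y) = −Q(x, Y y)` (Springer 7.4.7 (3)(b): `ᵗγ S γ = S ⇒ ᵗY S + S Y = 0`). -/
theorem skew_of_toMatrix_mem_lieAlgebraGL {Q : BilinForm K V} (hΓQ : ∀ γ ∈ Γ, ∀ x y, Q (γ x) (γ y) = Q x y)
    {Y : Module.End K V} (hY : LinearMap.toMatrix bV bV Y ∈ lieAlgebraGL (Γ.map Ψ.toMonoidHom)) (x y : V) :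
    Q (Y x) y = -Q x (Y y) := by
  set S := LinearMap.BilinForm.toMatrix bV Q with hS
  have hH : ∀ t ∈ Γ.map Ψ.toMonoidHom, (t : Matrix ι ι K)ᵀ * S * (t : Matrix ι ι K) = S := by
    rintro _ ⟨γ, hγ, rfl⟩
    change ((Ψ γ : GL ι K) : Matrix ι ι K)ᵀ * S * ((Ψ γ : GL ι K) : Matrix ι ι K) = S
    rw [hΨ, hS, ← LinearMap.BilinForm.toMatrix_comp bV bV]
    congr 1
    refine LinearMap.ext fun u => LinearMap.ext fun v => ?_
    rw [LinearMap.BilinForm.comp_apply, LinearEquiv.coe_coe]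
    exact hΓQ γ hγ u v
  have h := transpose_mul_add_mul_eq_zero_of_mem_lieAlgebraGL hH hY
  rw [hS, ← LinearMap.BilinForm.toMatrix_compLeft, ← LinearMap.BilinForm.toMatrix_compRight, ← map_add,
    LinearEquiv.map_eq_zero_iff] at h
  have h' := LinearMap.congr_fun (LinearMap.congr_fun h x) y
  rw [LinearMap.add_apply, LinearMap.add_apply, LinearMap.BilinForm.compLeft_apply, LinearMap.BilinForm.compRight_apply,
    LinearMap.zero_apply, LinearMap.zero_apply] at h'
  exact eq_neg_of_add_eq_zero_left h'

end General

/-! ### §2 Strong irreducibility of `Γ` on `M` ⇒ irreducibility of `Lie(Γ)` on `M` (`K = ℂ`) -/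

section Complex

variable {V : Type*} [AddCommGroup V] [Module ℂ V] {ι : Type*} [Fintype ι] [DecidableEq ι]
  (bV : Basis ι ℂ V) (Ψ : (V ≃ₗ[ℂ] V) ≃* GL ι ℂ)
  (hΨ : ∀ g : V ≃ₗ[ℂ] V, ((Ψ g : GL ι ℂ) : Matrix ι ι ℂ) = LinearMap.toMatrix bV bV (g : V →ₗ[ℂ] V))
  (Γ : Subgroup (V ≃ₗ[ℂ] V))

include hΨ in
/-- **STRONG irreducibility passes to the Lie algebra.** If every finite-index `Γ' ≤ Γ` leaves invariant no subspace `F ≤ M`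
other than `⊥` and `M`, then every subspace `W ≤ M` stable under all `Y` with `[Y]_{bV} ∈ Lie(Γ)` is `⊥` or `M` (the tree's
`eq_bot_or_eq_of_lieAlgebraGL_stable_of_forall_finiteIndex` — Tauvel–Yu 24.3.5 (ii) + Springer 2.2.1 — read through `bV`). -/
theorem eq_bot_or_eq_of_lie_stable_of_sirr (M : Submodule ℂ V)
    (h_sirr : ∀ Γ' : Subgroup (V ≃ₗ[ℂ] V), Γ' ≤ Γ → (Γ'.subgroupOf Γ).FiniteIndex →
      ∀ F : Submodule ℂ V, F ≤ M → (∀ γ ∈ Γ', ∀ x ∈ F, γ x ∈ F) → F = ⊥ ∨ F = M)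
    {W : Submodule ℂ V} (hWM : W ≤ M)
    (hW : ∀ Y : Module.End ℂ V, LinearMap.toMatrix bV bV Y ∈ lieAlgebraGL (Γ.map Ψ.toMonoidHom) → ∀ w ∈ W, Y w ∈ W) :
    W = ⊥ ∨ W = M := by
  classical
  set e : V ≃ₗ[ℂ] (ι → ℂ) := bV.equivFun with he
  set Γm : Subgroup (GL ι ℂ) := Γ.map Ψ.toMonoidHom with hΓm
  have hrepr : ∀ x : V, e x = bV.repr x := fun x => rfl
  -- matrix action of `γ ∈ Γ` and of `Y` through `e`
  have hγe : ∀ (γ : V ≃ₗ[ℂ] V) (x : V), ((Ψ γ : GL ι ℂ) : Matrix ι ι ℂ) *ᵥ e x = e (γ x) := by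
    intro γ x
    rw [hΨ, hrepr, hrepr, LinearMap.toMatrix_mulVec_repr]
    rfl
  -- the transported strong irreducibility hypothesis
  have hirr' : ∀ Δ' : Subgroup (GL ι ℂ), Δ' ≤ Γm → (Δ'.subgroupOf Γm).FiniteIndex →
      ∀ U : Submodule ℂ (ι → ℂ), U ≤ M.map (e : V →ₗ[ℂ] (ι → ℂ)) →
        (∀ g ∈ Δ', ∀ x ∈ U, ((g : GL ι ℂ) : Matrix ι ι ℂ) *ᵥ x ∈ U) → U = ⊥ ∨ U = M.map (e : V →ₗ[ℂ] (ι → ℂ)) := by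
    intro Δ' hΔ' hfi U hUM hU
    set Γ'' : Subgroup (V ≃ₗ[ℂ] V) := Δ'.comap Ψ.toMonoidHom with hΓ''
    have hΓ''le : Γ'' ≤ Γ := by
      intro x hx
      obtain ⟨y, hy, hyx⟩ := hΔ' hx
      rwa [← Ψ.injective hyx]
    have hmap : Γ''.map Ψ.toMonoidHom = Δ' := by
      rw [hΓ'', Subgroup.map_comap_eq_self_of_surjective]
      exact Ψ.surjective
    have hfi'' : (Γ''.subgroupOf Γ).FiniteIndex := by
      refine ⟨?_⟩
      change Γ''.relIndex Γ ≠ 0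
      have hri : (Γ''.map Ψ.toMonoidHom).relIndex (Γ.map Ψ.toMonoidHom) = Γ''.relIndex Γ :=
        Subgroup.relIndex_map_map_of_injective (f := Ψ.toMonoidHom) Γ'' Γ Ψ.injective
      rw [← hri, hmap]
      exact hfi.index_ne_zero
    set F : Submodule ℂ V := U.map (e.symm : (ι → ℂ) →ₗ[ℂ] V) with hF
    have hFM : F ≤ M := by
      rintro _ ⟨u, hu, rfl⟩
      obtain ⟨m, hm, hmu⟩ := hUM hu
      rw [← hmu]
      simpa using hm
    have hFst : ∀ γ ∈ Γ'', ∀ x ∈ F, γ x ∈ F := by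
      rintro γ hγ _ ⟨u, hu, rfl⟩
      have h1 : e (γ (e.symm u)) = ((Ψ γ : GL ι ℂ) : Matrix ι ι ℂ) *ᵥ u := by
        rw [← hγe γ (e.symm u), LinearEquiv.apply_symm_apply]
      exact ⟨e (γ (e.symm u)), by rw [h1]; exact hU _ (Subgroup.mem_comap.1 hγ) u hu, by simp⟩
    rcases h_sirr Γ'' hΓ''le hfi'' F hFM hFst with h0 | h1
    · left
      rw [eq_bot_iff]
      intro u hu
      have : e.symm u ∈ F := ⟨u, hu, rfl⟩
      rw [h0, Submodule.mem_bot, LinearEquiv.map_eq_zero_iff] at this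
      rw [Submodule.mem_bot, this]
    · right
      apply le_antisymm hUM
      rintro _ ⟨m, hm, rfl⟩
      have : m ∈ F := by rw [h1]; exact hm
      obtain ⟨u, hu, hum⟩ := this
      rw [← hum]
      simpa using hu
  -- `W.map e` is `Lie(Γm)`-stable
  have hWst : ∀ Z ∈ lieAlgebraGL Γm, ∀ x ∈ W.map (e : V →ₗ[ℂ] (ι → ℂ)), Z *ᵥ x ∈ W.map (e : V →ₗ[ℂ] (ι → ℂ)) := by
    rintro Z hZ _ ⟨w, hw, rfl⟩
    have hY : LinearMap.toMatrix bV bV (Matrix.toLin bV bV Z) ∈ lieAlgebraGL Γm := by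
      rw [LinearMap.toMatrix_toLin]; exact hZ
    refine ⟨Matrix.toLin bV bV Z w, hW _ hY w hw, ?_⟩
    rw [LinearEquiv.coe_coe, hrepr, hrepr, ← LinearMap.toMatrix_mulVec_repr bV bV, LinearMap.toMatrix_toLin]
  rcases eq_bot_or_eq_of_lieAlgebraGL_stable_of_forall_finiteIndex Γm (M.map (e : V →ₗ[ℂ] (ι → ℂ))) hirr'
    (Submodule.map_mono hWM) hWst with h0 | h1
  · left
    exact (Submodule.map_injective_of_injective e.injective) (by rw [h0, Submodule.map_bot])
  · right
    exact (Submodule.map_injective_of_injective e.injective) h1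

end Complex

/-! ### §3 The symplectic form `ω(x, y) = Q(x, b y)` on `M = ker(a − i)` -/

section Omega

variable {K : Type*} [Field K] [CharZero K] {V : Type*} [AddCommGroup V] [Module K V]
  {Q : BilinForm K V} {a b : V →ₗ[K] V} {i : K}

/-- `ω(x, x) = Q(x, b x) = 0`: the restriction of `Q(·, b ·)` to `M` is alternating. -/
theorem omegaM_isAlt (hQs : ∀ x y, Q x y = Q y x) (hbb : ∀ x, b (b x) = -x) (hQb : ∀ x y, Q (b x) (b y) = Q x y) :
    (Q.compl₁₂ (Module.End.eigenspace a i).subtype (b ∘ₗ (Module.End.eigenspace a i).subtype)).IsAlt := by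
  intro x
  simp only [LinearMap.compl₁₂_apply, Submodule.coe_subtype, LinearMap.coe_comp, Function.comp_apply]
  exact b_self hQs hbb hQb (x : V)

/-- A vector of `M` that is `Q(·, b ·)`-orthogonal to `M` vanishes (`V = M ⊕ bM`, `M` totally `Q`-isotropic). -/
theorem eq_zero_of_forall_omega_eq_zero (hQn : Q.Nondegenerate) (haa : ∀ x, a (a x) = -x) (hbb : ∀ x, b (b x) = -x)
    (hab : ∀ x, a (b x) = -b (a x)) (haQ : ∀ x y, Q (a x) (a y) = Q x y) (hi : i * i = -1) {x : V} (hx : a x = i • x)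
    (h : ∀ m, a m = i • m → Q x (b m) = 0) : x = 0 := by
  refine hQn.1 x fun z => ?_
  have h1 : Q x (z - i • a z) = 0 := eigen_isotropic haQ hi hx (a_sub_smul haa hi z)
  have h2 : Q x (z + i • a z) = 0 := by
    have hy : a (b (z + i • a z)) = i • b (z + i • a z) := a_b_of_neg hab (a_add_smul haa hi z)
    have h3 : Q x (b (b (z + i • a z))) = 0 := h _ hy
    rwa [hbb, map_neg, neg_eq_zero] at h3
  have h4 : Q x ((2 : K) • z) = 0 := by
    have : (2 : K) • z = (z - i • a z) + (z + i • a z) := by module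
    rw [this, map_add, h1, h2, add_zero]
  rw [map_smul, smul_eq_mul] at h4
  exact (mul_eq_zero.1 h4).resolve_left two_ne_zero

/-- **`ω(x, y) = Q(x, b y)` is non-degenerate on `M = ker(a − i)`.** -/
theorem omegaM_nondegenerate (hQs : ∀ x y, Q x y = Q y x) (hQn : Q.Nondegenerate) (haa : ∀ x, a (a x) = -x)
    (hbb : ∀ x, b (b x) = -x) (hab : ∀ x, a (b x) = -b (a x)) (haQ : ∀ x y, Q (a x) (a y) = Q x y)
    (hQb : ∀ x y, Q (b x) (b y) = Q x y) (hi : i * i = -1) :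
    (Q.compl₁₂ (Module.End.eigenspace a i).subtype (b ∘ₗ (Module.End.eigenspace a i).subtype)).Nondegenerate := by
  have key : ∀ x : Module.End.eigenspace a i,
      (∀ y : Module.End.eigenspace a i, Q (x : V) (b (y : V)) = 0) → x = 0 := by
    intro x hx
    apply Subtype.ext
    refine eq_zero_of_forall_omega_eq_zero hQn haa hbb hab haQ hi (Module.End.mem_eigenspace_iff.1 x.2) fun m hm => ?_
    exact hx ⟨m, Module.End.mem_eigenspace_iff.2 hm⟩
  refine ⟨fun x hx => key x fun y => ?_, fun y hy => key y fun x => ?_⟩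
  · simpa [LinearMap.compl₁₂_apply] using hx y
  · have := hy x
    simp only [LinearMap.compl₁₂_apply, Submodule.coe_subtype, LinearMap.coe_comp, Function.comp_apply] at this
    rw [b_skew hQs hbb hQb, this, neg_zero]

/-- **`M ∖ {0}` is ω-orthogonally connected**: a non-empty proper subset `A` of the non-zero vectors of `M` contains some `r`
with `Q(r, b ρ) ≠ 0` for some non-zero `ρ ∈ M ∖ A` (else, with `ρ₀ ∉ A`: for `r ∈ A` and `m ∈ M`, either some `m + t ρ₀ ∉ A`
and `r ⊥ m`, or `ρ₀ ⊥ M`, contradicting non-degeneracy). This is the connectivity hypothesis of the quaternionic Lemma T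
(`mem_glZariskiClosure_of_quaternionic`) for `R = M ∖ {0}`. -/
theorem sirr_conn (hQs : ∀ x y, Q x y = Q y x) (hQn : Q.Nondegenerate) (haa : ∀ x, a (a x) = -x)
    (hbb : ∀ x, b (b x) = -x) (hab : ∀ x, a (b x) = -b (a x)) (haQ : ∀ x y, Q (a x) (a y) = Q x y)
    (hQb : ∀ x y, Q (b x) (b y) = Q x y) (hi : i * i = -1) :
    ∀ A ⊆ {v : V | a v = i • v ∧ v ≠ 0}, A.Nonempty → A ≠ {v : V | a v = i • v ∧ v ≠ 0} →
      ∃ r ∈ A, ∃ ρ ∈ {v : V | a v = i • v ∧ v ≠ 0}, ρ ∉ A ∧ Q r (b ρ) ≠ 0 := by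
  intro A hAR hAne hAR'
  by_contra hcon
  push Not at hcon
  -- some `ρ₀ ∈ R ∖ A`
  obtain ⟨ρ₀, hρ₀R, hρ₀A⟩ : ∃ ρ₀ ∈ {v : V | a v = i • v ∧ v ≠ 0}, ρ₀ ∉ A := by
    by_contra hall
    push Not at hall
    exact hAR' (Set.Subset.antisymm hAR hall)
  obtain ⟨r, hrA⟩ := hAne
  have hrR := hAR hrA
  -- orthogonality is symmetric up to sign
  have hsym : ∀ x y : V, Q x (b y) = 0 → Q y (b x) = 0 := fun x y h => by
    rw [b_skew hQs hbb hQb, h, neg_zero]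
  -- Claim: `Q r (b m) = 0` for every `m ∈ M`, whence `r = 0`
  have hclaim : ∀ m, a m = i • m → Q r (b m) = 0 := by
    intro m hm
    by_cases hmA : m ∈ A
    swap
    · by_cases hm0 : m = 0
      · rw [hm0, map_zero, map_zero]
      · exact hcon r hrA m ⟨hm, hm0⟩ hmA
    -- `m ∈ A`: look at the line `m + t ρ₀`
    by_cases hline : ∃ t : K, m + t • ρ₀ ∉ A
    · obtain ⟨t, ht⟩ := hline
      have hmt : a (m + t • ρ₀) = i • (m + t • ρ₀) := by rw [map_add, map_smul, hm, hρ₀R.1, smul_comm, smul_add]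
      have h1 : Q r (b (m + t • ρ₀)) = 0 := by
        by_cases h0 : m + t • ρ₀ = 0
        · rw [h0, map_zero, map_zero]
        · exact hcon r hrA _ ⟨hmt, h0⟩ ht
      have h2 : Q r (b ρ₀) = 0 := hcon r hrA ρ₀ hρ₀R hρ₀A
      rw [map_add, map_smul, map_add, map_smul, h2, smul_eq_mul, mul_zero, add_zero] at h1
      exact h1
    · push Not at hline
      -- every `m + t ρ₀ ∈ A`, so `ρ₀ ⊥ (m + t ρ₀)` for `t = 0, 1`, hence `ρ₀ ⊥ ρ₀`-translate: `ρ₀ ⊥ M`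
      exfalso
      have hperpA : ∀ x ∈ A, Q ρ₀ (b x) = 0 := fun x hx => hsym x ρ₀ (hcon x hx ρ₀ hρ₀R hρ₀A)
      have hρM : ∀ m', a m' = i • m' → Q ρ₀ (b m') = 0 := by
        intro m' hm'
        by_cases hm'A : m' ∈ A
        · exact hperpA m' hm'A
        · by_cases hm'0 : m' = 0
          · rw [hm'0, map_zero, map_zero]
          · -- `m' ∈ R ∖ A`: use `m + m' ∈ A`? compare `m + 1•ρ₀ ∈ A` and the pair `(m + ρ₀, m')`… simpler: `ρ₀ ⊥ m'` fails only if
            -- `m' ∉ A`, but then `hcon (m + ρ₀) … m'` gives `(m + ρ₀) ⊥ m'` and `hcon m … m'` gives `m ⊥ m'`, so `ρ₀ ⊥ m'`.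
            have h1 : Q (m + (1 : K) • ρ₀) (b m') = 0 := hcon _ (hline 1) m' ⟨hm', hm'0⟩ hm'A
            have h2 : Q m (b m') = 0 := hcon m hmA m' ⟨hm', hm'0⟩ hm'A
            rw [one_smul, map_add, LinearMap.add_apply, h2, zero_add] at h1
            exact h1
      exact hρ₀R.2 (eq_zero_of_forall_omega_eq_zero hQn haa hbb hab haQ hi hρ₀R.1 hρM)
  exact hrR.2 (eq_zero_of_forall_omega_eq_zero hQn haa hbb hab haQ hi hrR.1 hclaim)

end Omega

end Summit.HodgeConjecture.HodgeConjecture.Theorems.Q8MonodromyLieAlgebra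

end
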